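import Summits.QuantumFields.QCD.Theses.HeatSlicedQuarks

/-!
# Sketch — first lemmas of three crux ideas for `TracedQuadraticParametrix` (stmt-QuantumFields-17985)
crux-ideate round 1, ideator 1 (planner-cruxidea-stmt-QuantumFields-17985-1-0).

* card `tstar-squaring-bootstrap`   : `TStarTracedSplitting` (provable now), `WeightedColumnIdentification`,
                                       `TracedColumnProfile` (transfer target C⁺), `TracedColumnPairing`.
* card `schwarz-double-zero`        : `SchwarzDoubleZero` (Mathlib-provable), `ComplexStripDiagonalBound`.
* card `curvature-hessian-form-factor` : `CurvatureHessianBound`, `CubicRemainderBound`.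
Nothing here is proved; every `def … : Prop` only has to elaborate.
-/

noncomputable section

namespace Summit.QuantumFields.QCD.Cruxes.TracedQuadraticParametrix.IdeasR1I1

open Literature.MathematicalPhysics.QuantumLattice Literature.MathematicalPhysics.QuantumFieldTheory
  Literature.Probability.LatticeModels
open Summit.QuantumFields.QCD.Theses.HeatSlicedQuarks
open scoped Matrix ComplexConjugate

/-- `SU(3)` for short. -/
abbrev SU3 := Matrix.specialUnitaryGroup (Fin 3) ℂ

/-- The free configuration `U ≡ 1`. -/
abbrev freeCfg (L : ℕ) : GaugeConfig 4 L SU3 := fun _ => 1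

/-- `H_U = D_W(U,m,1)ᴴ D_W(U,m,1)` (Wilson parameter `r = 1`, fundamental `SU(3)`). -/
abbrev hsq {L : ℕ} [NeZero L] (U : GaugeConfig 4 L SU3) (m : ℝ) :
    Matrix (TorusSite 4 L × Fin 3 × Fin 4) (TorusSite 4 L × Fin 3 × Fin 4) ℂ :=
  (wilsonDirac (fundamentalRep (Fin 3)) U m 1)ᴴ * wilsonDirac (fundamentalRep (Fin 3)) U m 1

/-- The heat kernel `K_U(t) = e^{-t H_U}` as a matrix. -/
abbrev heat {L : ℕ} [NeZero L] (U : GaugeConfig 4 L SU3) (m t : ℝ) :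
    Matrix (TorusSite 4 L × Fin 3 × Fin 4) (TorusSite 4 L × Fin 3 × Fin 4) ℂ :=
  NormedSpace.exp (-(t : ℂ) • hsq U m)

/-! ## Card `tstar-squaring-bootstrap` -/

/-- **T\*T traced splitting** (exact identity, provable now from `K(2s) = K(s)ᴴ K(s)` for the Hermitian
`H_U`, cf. the landed `exp_neg_smul_apply_self_eq_sum_norm_sq`): the crux quantity at time `2s` is
`2 Re ⟨free column, correction column⟩ + ‖correction column‖²`, summed over the 12 colour–spin columns at `x`.
Valid in ANY gauge (both terms are gauge dependent, their sum is not). -/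
def TStarTracedSplitting : Prop :=
  ∀ (L : ℕ) [NeZero L] (U : GaugeConfig 4 L SU3) (m s : ℝ), 0 ≤ s → ∀ x : TorusSite 4 L,
    (∑ a : Fin 3, ∑ α : Fin 4, (heat U m (2 * s) (x, a, α) (x, a, α)).re) -
        (∑ a : Fin 3, ∑ α : Fin 4, (heat (freeCfg L) m (2 * s) (x, a, α) (x, a, α)).re) =
      2 * (∑ a : Fin 3, ∑ α : Fin 4, ∑ q : TorusSite 4 L × Fin 3 × Fin 4,
            conj (heat (freeCfg L) m s q (x, a, α)) *
              (heat U m s q (x, a, α) - heat (freeCfg L) m s q (x, a, α))).re +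
        ∑ a : Fin 3, ∑ α : Fin 4, ∑ q : TorusSite 4 L × Fin 3 × Fin 4,
          ‖heat U m s q (x, a, α) - heat (freeCfg L) m s q (x, a, α)‖ ^ 2

/-- **Weighted column identification** (input of the bootstrap; the landed p111007 is the unweighted case
`p = 0`): in a gauge with the linear link-deficit profile centred at `x` and global `(ε/r²)²`-smallness, the
correction column at `x` is `O(ε/r²)` in the ℓ² norm WEIGHTED by `(1 + d(x,·)²/(1+s))²`, `0 ≤ 2s ≤ r²`. -/
def WeightedColumnIdentification : Prop :=
  ∀ C_A : ℝ, 0 ≤ C_A → ∃ ε₀ : ℝ, 0 < ε₀ ∧ ∃ C : ℝ, ∀ (L : ℕ) [NeZero L]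
    (W : GaugeConfig 4 L SU3) (m : ℝ), m ∈ Set.Icc (-(1 / 2 : ℝ)) 1 →
    ∀ (r : ℕ), 1 ≤ r → r ≤ L → ∀ (ε : ℝ), 0 < ε → ε ≤ ε₀ →
    (∀ (y : TorusSite 4 L) (μ ν : Fin 4),
      3 - ((fundamentalRep (Fin 3)) (plaquetteHolonomy W y μ ν)).trace.re ≤ (ε / (r : ℝ) ^ 2) ^ 2) →
    ∀ (x : TorusSite 4 L),
    (∀ (z : TorusSite 4 L) (μ : Fin 4),
      3 - ((fundamentalRep (Fin 3)) (W (z, μ))).trace.re ≤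
        C_A * ((torusDist x z : ℝ) + 1) ^ 2 * (ε / (r : ℝ) ^ 2) ^ 2) →
    ∀ (s : ℝ), 0 ≤ s → 2 * s ≤ (r : ℝ) ^ 2 → ∀ (a : Fin 3) (α : Fin 4),
      Real.sqrt (∑ q : TorusSite 4 L × Fin 3 × Fin 4,
          (1 + (torusDist x q.1 : ℝ) ^ 2 / (1 + s)) ^ 4 *
            ‖heat W m s q (x, a, α) - heat (freeCfg L) m s q (x, a, α)‖ ^ 2) ≤ C * (ε / (r : ℝ) ^ 2)

/-- **Traced column profile** (transfer target C⁺ of the bootstrap): on tori large enough to host the global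
comb gauge (`A r²/ε ≤ L`), the COLOUR TRACE of the correction column at `x` is SECOND order with the free
off-diagonal profile: `|Σ_a (K_W(s) − K_1(s))((z,a,β),(x,a,α))| ≤ C (ε/r²)² (1 + d(x,z)²/s)⁻³` for
`1 ≤ s`, `2s ≤ r²`.  (First order vanishes for every `z`: the first column Duhamel term has colour blocks
`X_e ⊗ (spin)`, `tr X_e = 0`.)  Proved scale-by-scale: `K(2s) = K(s)K(s)`, re-rooting of the comb at the
intermediate point, `tr (hol − 1) = −½‖hol − 1‖²_F + O(‖hol−1‖³)` for the re-rooting holonomies. -/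
def TracedColumnProfile : Prop :=
  ∀ C_A : ℝ, 0 ≤ C_A → ∃ ε₀ : ℝ, 0 < ε₀ ∧ ∃ A C : ℝ, ∀ (L : ℕ) [NeZero L]
    (W : GaugeConfig 4 L SU3) (m : ℝ), m ∈ Set.Icc (-(1 / 2 : ℝ)) 1 →
    ∀ (r : ℕ), 1 ≤ r → r ≤ L → ∀ (ε : ℝ), 0 < ε → ε ≤ ε₀ →
    (∀ (y : TorusSite 4 L) (μ ν : Fin 4),
      3 - ((fundamentalRep (Fin 3)) (plaquetteHolonomy W y μ ν)).trace.re ≤ (ε / (r : ℝ) ^ 2) ^ 2) →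
    A * (r : ℝ) ^ 2 / ε ≤ (L : ℝ) →
    ∀ (x : TorusSite 4 L),
    (∀ (z : TorusSite 4 L) (μ : Fin 4),
      3 - ((fundamentalRep (Fin 3)) (W (z, μ))).trace.re ≤
        C_A * ((torusDist x z : ℝ) + 1) ^ 2 * (ε / (r : ℝ) ^ 2) ^ 2) →
    ∀ (s : ℝ), 1 ≤ s → 2 * s ≤ (r : ℝ) ^ 2 → ∀ (z : TorusSite 4 L) (α β : Fin 4),
      ‖∑ a : Fin 3, (heat W m s (z, a, β) (x, a, α) - heat (freeCfg L) m s (z, a, β) (x, a, α))‖ ≤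
        C * (ε / (r : ℝ) ^ 2) ^ 2 * ((1 + (torusDist x z : ℝ) ^ 2 / s) ^ 3)⁻¹

/-- **Traced column pairing** (what the T\*T splitting leaves of the crux once the landed
`ColumnIdentification` has paid `‖Δ‖² ≤ 12 C² (ε/r²)²`): the correction column is ℓ²-orthogonal to the free
column up to `O((ε/r²)²)`, on large tori, `1 ≤ s`, `2s ≤ r²`.  Immediate from `TracedColumnProfile` and the
free profile `|K_1(s)(z,x)| ≤ C s⁻²(1 + d²/s)⁻³` (landed `FreeColumnProfile` shape). -/
def TracedColumnPairing : Prop :=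
  ∀ C_A : ℝ, 0 ≤ C_A → ∃ ε₀ : ℝ, 0 < ε₀ ∧ ∃ A C : ℝ, ∀ (L : ℕ) [NeZero L]
    (W : GaugeConfig 4 L SU3) (m : ℝ), m ∈ Set.Icc (-(1 / 2 : ℝ)) 1 →
    ∀ (r : ℕ), 1 ≤ r → r ≤ L → ∀ (ε : ℝ), 0 < ε → ε ≤ ε₀ →
    (∀ (y : TorusSite 4 L) (μ ν : Fin 4),
      3 - ((fundamentalRep (Fin 3)) (plaquetteHolonomy W y μ ν)).trace.re ≤ (ε / (r : ℝ) ^ 2) ^ 2) →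
    A * (r : ℝ) ^ 2 / ε ≤ (L : ℝ) →
    ∀ (x : TorusSite 4 L),
    (∀ (z : TorusSite 4 L) (μ : Fin 4),
      3 - ((fundamentalRep (Fin 3)) (W (z, μ))).trace.re ≤
        C_A * ((torusDist x z : ℝ) + 1) ^ 2 * (ε / (r : ℝ) ^ 2) ^ 2) →
    ∀ (s : ℝ), 1 ≤ s → 2 * s ≤ (r : ℝ) ^ 2 →
      |(∑ a : Fin 3, ∑ α : Fin 4, ∑ q : TorusSite 4 L × Fin 3 × Fin 4,
          conj (heat (freeCfg L) m s q (x, a, α)) *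
            (heat W m s q (x, a, α) - heat (freeCfg L) m s q (x, a, α))).re| ≤ C * (ε / (r : ℝ) ^ 2) ^ 2

/-! ## Card `schwarz-double-zero` -/

/-- **Schwarz lemma with a double zero** (Mathlib-provable: maximum modulus for `g(θ)/θ²`): a holomorphic
`g` on the disc of radius `R ≥ 1`, bounded by `M`, with `g(0) = g'(0) = 0`, satisfies `|g(1)| ≤ M/R²`. -/
def SchwarzDoubleZero : Prop :=
  ∀ (g : ℂ → ℂ) (R M : ℝ), 1 ≤ R → DifferentiableOn ℂ g (Metric.ball 0 R) →
    ContinuousOn g (Metric.closedBall 0 R) → g 0 = 0 → deriv g 0 = 0 →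
    (∀ θ ∈ Metric.closedBall (0 : ℂ) R, ‖g θ‖ ≤ M) → ‖g 1‖ ≤ M / R ^ 2

/-- **Complex-strip diagonal bound** (the load-bearing stub of the Schwarz line; a complex, size-only version
of the CLOSED crux 8871): let `U` be an `SU(3)` field, globally `(ε₀/r²)²`-small, and `V` a `GL(3,ℂ)`-valued
deformation of it supported within distance `R ≲ r√(1 + log r²)` of `x`, entrywise within
`c₀ (d(x,e)+1)/r²` of `U` (linearly growing strip, rate `c₀/r²`); then the `(x,x)` colour–spin entries of
`exp(−t (γ₅ D_W(V))²)` — the holomorphic extension of `e^{-t D_Wᴴ D_W}` (`hermitianWilsonDirac_mul_self`,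
`stub_holomorphicGaugeCovariance`) — keep the free size `C/t²` for `1 ≤ t ≤ r²`. -/
def ComplexStripDiagonalBound : Prop :=
  ∃ c₀ : ℝ, 0 < c₀ ∧ ∃ ε₀ : ℝ, 0 < ε₀ ∧ ∃ K : ℕ, ∃ A C : ℝ, 0 < A ∧ ∀ (L : ℕ) [NeZero L]
    (U : GaugeConfig 4 L SU3) (V : GaugeConfig 4 L (Matrix.GeneralLinearGroup (Fin 3) ℂ)) (m : ℝ),
    m ∈ Set.Icc (-(1 / 2 : ℝ)) 1 → ∀ (r : ℕ), 1 ≤ r → r ≤ L → ∀ (x : TorusSite 4 L),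
    (∀ (y : TorusSite 4 L), torusDist x y ≤ K * r → ∀ (μ ν : Fin 4),
      3 - ((fundamentalRep (Fin 3)) (plaquetteHolonomy U y μ ν)).trace.re ≤ (ε₀ / (r : ℝ) ^ 2) ^ 2) →
    ∀ (R : ℝ), R ^ 2 ≤ A * (r : ℝ) ^ 2 * (1 + Real.log ((r : ℝ) ^ 2)) →
    (∀ (e : Edge 4 L) (i j : Fin 3),
      ‖((V e : Matrix.GeneralLinearGroup (Fin 3) ℂ) : Matrix (Fin 3) (Fin 3) ℂ) i j -
          (fundamentalRep (Fin 3)) (U e) i j‖ ≤ c₀ * ((torusDist x e.1 : ℝ) + 1) / (r : ℝ) ^ 2) →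
    (∀ (e : Edge 4 L), R < (torusDist x e.1 : ℝ) →
      ((V e : Matrix.GeneralLinearGroup (Fin 3) ℂ) : Matrix (Fin 3) (Fin 3) ℂ) = (fundamentalRep (Fin 3)) (U e)) →
    ∀ (t : ℝ), 1 ≤ t → t ≤ (r : ℝ) ^ 2 → ∀ (a b : Fin 3) (α β : Fin 4),
      ‖(NormedSpace.exp (-(t : ℂ) •
          (spinorLift gammaFive * wilsonDirac (Units.coeHom (Matrix (Fin 3) (Fin 3) ℂ)) V m 1) ^ 2) :
          Matrix (TorusSite 4 L × Fin 3 × Fin 4) (TorusSite 4 L × Fin 3 × Fin 4) ℂ)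
          (x, a, α) (x, b, β)‖ ≤ C / t ^ 2

/-! ## Card `curvature-hessian-form-factor` -/

/-- **Curvature Hessian bound** (lattice Barvinsky–Vilkovisky form factor, second order): along the
exponential line `θ ↦ e^{θX}` through the flat connection (`X_e ∈ su(3)`), the second derivative at `θ = 0` of
the traced on-diagonal heat kernel is bounded by the SQUARE of the LINEARISED PLAQUETTE FLUX of `X` in the
affine-in-`d²` profile `‖f_p‖ ≤ φ₀ + φ₂ d(x,p)²` (Gaussian-weighted: `φ₂` costs `t`), the amplitude entering only
through its SLOPE `B₁` (`‖X_e‖ ≤ B₁ (d+1)`; the Hessian at the critical point `1` annihilates lattice gradients `dλ` —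
Ward identity — and the harmonic/winding part is `≤ C B₁²·(L⁴/t²)e^{-cL²/t} ≤ C B₁²`), uniformly in `1 ≤ t ≤ L²`.
For the comb chart of the crux: `φ₀ = 2√2 δ`, `φ₂ = C₂δ²`, `B₁ = C₁δ`, `δ = ε/r²`, `φ₂ t ≤ C₂ ε δ`. -/
def CurvatureHessianBound : Prop :=
  ∃ C : ℝ, ∀ (L : ℕ) [NeZero L] (m : ℝ), m ∈ Set.Icc (-(1 / 2 : ℝ)) 1 →
    ∀ (X : Edge 4 L → Matrix (Fin 3) (Fin 3) ℂ), (∀ e, (X e)ᴴ = -X e) → (∀ e, (X e).trace = 0) →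
    ∀ (Uθ : ℝ → GaugeConfig 4 L SU3),
    (∀ (θ : ℝ) (e : Edge 4 L), (fundamentalRep (Fin 3)) (Uθ θ e) = NormedSpace.exp ((θ : ℂ) • X e)) →
    ∀ (x : TorusSite 4 L) (t φ₀ φ₂ B₁ : ℝ), 1 ≤ t → t ≤ (L : ℝ) ^ 2 →
    (∀ (y : TorusSite 4 L) (μ ν : Fin 4) (i j : Fin 3),
      ‖(X (y, μ) + X (Site.shift y μ, ν) - X (Site.shift y ν, μ) - X (y, ν)) i j‖ ≤
        φ₀ + φ₂ * (torusDist x y : ℝ) ^ 2) →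
    (∀ (e : Edge 4 L) (i j : Fin 3), ‖X e i j‖ ≤ B₁ * ((torusDist x e.1 : ℝ) + 1)) →
      |iteratedDeriv 2 (fun θ : ℝ => ∑ a : Fin 3, ∑ α : Fin 4, (heat (Uθ θ) m t (x, a, α) (x, a, α)).re) 0| ≤
        C * (φ₀ + φ₂ * t + B₁) ^ 2

/-- **Cubic remainder bound** (third order of the same Taylor expansion, no cancellation needed: three
vertices each costing `ε/r²` per unit proper time — `(εt/r²)³/t² ≤ (ε/r²)³ t`): along the exponential line
from `1` to the comb-gauged field `W = e^{X}` (amplitude profile `‖X_e‖ ≤ √C_A (d+1) ε/r²`), on large tori,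
the third `θ`-derivative of the traced diagonal kernel is `≤ C (ε/r²)³ t` uniformly on `θ ∈ [0,1]`. -/
def CubicRemainderBound : Prop :=
  ∀ C_A : ℝ, 0 ≤ C_A → ∃ ε₀ : ℝ, 0 < ε₀ ∧ ∃ A C : ℝ, ∀ (L : ℕ) [NeZero L] (m : ℝ),
    m ∈ Set.Icc (-(1 / 2 : ℝ)) 1 → ∀ (r : ℕ), 1 ≤ r → r ≤ L → ∀ (ε : ℝ), 0 < ε → ε ≤ ε₀ →
    A * (r : ℝ) ^ 2 / ε ≤ (L : ℝ) →
    ∀ (X : Edge 4 L → Matrix (Fin 3) (Fin 3) ℂ), (∀ e, (X e)ᴴ = -X e) → (∀ e, (X e).trace = 0) →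
    ∀ (Uθ : ℝ → GaugeConfig 4 L SU3),
    (∀ (θ : ℝ) (e : Edge 4 L), (fundamentalRep (Fin 3)) (Uθ θ e) = NormedSpace.exp ((θ : ℂ) • X e)) →
    (∀ (y : TorusSite 4 L) (μ ν : Fin 4),
      3 - ((fundamentalRep (Fin 3)) (plaquetteHolonomy (Uθ 1) y μ ν)).trace.re ≤ (ε / (r : ℝ) ^ 2) ^ 2) →
    ∀ (x : TorusSite 4 L),
    (∀ (e : Edge 4 L) (i j : Fin 3), ‖X e i j‖ ≤ Real.sqrt C_A * ((torusDist x e.1 : ℝ) + 1) * (ε / (r : ℝ) ^ 2)) →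
    ∀ (t : ℝ), 1 ≤ t → t ≤ (r : ℝ) ^ 2 → ∀ θ ∈ Set.Icc (0 : ℝ) 1,
      |iteratedDeriv 3 (fun θ' : ℝ => ∑ a : Fin 3, ∑ α : Fin 4, (heat (Uθ θ') m t (x, a, α) (x, a, α)).re) θ| ≤
        C * (ε / (r : ℝ) ^ 2) ^ 3 * t

end Summit.QuantumFields.QCD.Cruxes.TracedQuadraticParametrix.IdeasR1I1

end
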